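import Literature.NumberTheory.Automorphic.AutomorphicAnalyticVectorsGeneral
import HarnessLib

/-!
# Nelson analyticity of the whole `U(𝔤)`-span of a `Δ`-finite subspace (general automorphy datum)

Topic `NumberTheory/Automorphic`; sequel of `AutomorphicAnalyticVectorsGeneral`. There, for an
`L²`-Lie-stable space `W` of smooth functions and a finite-dimensional `V ≤ W` stable under
Nelson's Laplacian `Δ = ∑ᵢ Xᵢ²` (in particular a `𝔨`-stable `𝔭^∓`-null `V`), the `L²`-orbits
`t ↦ R(exp tX) [φ]` of the classes of the elements of `V` are shown to be real analytic. Harish-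
Chandra's closure theorem (`closure_l2OfForms_exp_invariant_of_analytic(_of_memLp)`) is applied
to the `𝔤`-STABLE space generated by `V`, i.e. to all iterated Lie derivatives
`X₁ (X₂ (⋯ (Xₙ ψ)))`, `ψ ∈ V`, and their linear combinations; this file proves that these, too,
have analytic orbits. The point (Nelson 1959, §8; Harish-Chandra 1953, Lemma 34: the space of
well-behaved vectors is `π(𝔅)`-stable) is that Nelson's recursion bounds EVERY word:
`‖X^m (A_α φ)‖ ≤ s^m M^{m+|α|} (m+|α|)! ‖φ‖` for `φ` in the `Δ`-stable `T` and `A_α` a word of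
length `|α|` in the generators, and `(m+n)! ≤ 2^{m+n} m! n!`, so the orbit of `[A_α φ]` still has
factorially bounded derivatives.

* `Literature.Analysis.OperatorTheory.norm_pow_sum_smul_mul_wordOp_le_of_laplacian_stable` — the
  mixed word estimate (the inductive step "peel one factor" inside
  `norm_pow_sum_smul_le_of_laplacian_stable`, recorded as a statement).
* (private) `factorial_add_le_two_pow_mul_factorial_mul` — `(m + n)! ≤ 2^(m+n) m! n!`.
* `IsL2LieStable.exists_norm_cl_lieHom_pow_prod_le`, `…analyticAt_rightRegular_cl_prod_of_laplacian_stable`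
  — Nelson's estimate and analyticity for `[A_α φ]`, `φ ∈ T`, `A_α` a word in the generators.
* `IsL2LieStable.analyticAt_rightRegular_cl_of_mem_span_prod` — the same for every element of the
  span `G` of the `A_α φ` (the analytic vectors form a subspace), and `lieHom_apply_mem_span_prod`
  (`G` is `𝔤`-stable), `mk_iterLieDeriv_mem_span_prod` (`G` contains all iterated Lie derivatives
  of elements of `T` along arbitrary `X ∈ 𝔤`).
* `IsL2LieStable.analyticAt_rightRegular_toLp_of_mem_lieSpan_of_laplacian_stable` and
  `…_of_mem_lieSpan_of_null` (+ `inner` forms) — **the `ρ`-free statements**: for `φ` in the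
  complex span of the iterated Lie derivatives `X₁ (⋯ (Xₙ ψ))` (`Xᵢ ∈ 𝔤`, `ψ ∈ V`) of a
  `Δ`-stable (resp. `𝔨`-stable `𝔭^∓`-null) finite-dimensional `V ≤ W`, and `f ∈ ℒ²(μ)` with
  `invQuot f = φ`, the orbit `t ↦ R(exp tX) [f]` (resp. the coefficient `⟪u, R(exp tX) [f]⟫`) is
  real analytic at every `t₀`. This span is the `𝔤`-stable space `W'` to which the closure theorem
  is applied (`hana` for every element of `W'`).

Everything is proved; no definition.

## References

* E. Nelson, *Analytic vectors*, Ann. of Math. 70 (1959), 572–615, §8 [Nelson1959].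
* Harish-Chandra, *Representations of a semisimple Lie group on a Banach space. I*, Trans. AMS 75
  (1953), §7 (Thm. 2: `π(b)ψ` is well-behaved with `ψ`), Lemma 34 (p. 228) [HarishChandraTAMS1953].
-/

-- Mathlib idiom (Mathlib/Algebra/Lie/OfAssociative.lean, where `LieRing.ofAssociativeRing` is a `def` made a
-- local instance file by file); needed to speak of `𝔤 →ₗ⁅ℝ⁆ Module.End ℂ W` and of `𝒟.arch.lie`
attribute [local instance 100] LieRing.ofAssociativeRing

open scoped MatrixGroups Matrix ContDiff Topology InnerProductSpace
open Filter Finset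
open _root_.MeasureTheory

noncomputable section

/-! ### 0. The mixed word estimate and a factorial inequality -/

namespace Literature.Analysis.OperatorTheory

variable {H : Type*} [NormedAddCommGroup H] [InnerProductSpace ℂ H] {ι : Type*} [Fintype ι]

/-- **Nelson's estimate for `A_X^k A_α`.** Under the hypotheses of
`norm_wordOp_le_of_laplacian_stable` (skew-symmetric family `A` with structure constants bounded by
`c`, finite-dimensional `Δ`-stable `T` with `‖Δ w‖ ≤ B ‖w‖` on `T`), for `x : ι → ℝ`, a word `α`
and `w ∈ T`: `‖(A_X^k ∘ A_α) w‖ ≤ (∑|xᵢ|)^k · M^(k+|α|) · (k+|α|)! · ‖w‖`, `M = √B + 2 d² c`,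
`A_X = ∑ xᵢ Aᵢ` (expand one factor of `A_X` at a time: `A_X^{k+1} A_α = ∑ᵢ xᵢ A_X^k A_{i∷α}`).
Nelson 1959, §8 (the `Δ`-finite case). [cite: Nelson1959, §8] -/
theorem norm_pow_sum_smul_mul_wordOp_le_of_laplacian_stable (A : ι → Module.End ℂ H)
    (hskew : ∀ i u w, ⟪A i u, w⟫_ℂ = -⟪u, A i w⟫_ℂ) (c : ι → ι → ι → ℝ)
    (hbr : ∀ i m, A i * A m - A m * A i = ∑ l, (c i m l : ℂ) • A l) {cM : ℝ} (hcM : 0 ≤ cM)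
    (hc : ∀ i m l, |c i m l| ≤ cM) {T : Submodule ℂ H}
    (hT : ∀ w ∈ T, laplacian A w ∈ T) {B : ℝ} (hB0 : 0 ≤ B)
    (hB : ∀ w ∈ T, ‖laplacian A w‖ ≤ B * ‖w‖)
    (x : ι → ℝ) (k : ℕ) (α : List ι) {w : H} (hw : w ∈ T) :
    ‖((∑ i, (x i : ℂ) • A i) ^ k * wordOp A α) w‖ ≤
      (∑ i, |x i|) ^ k * ((Real.sqrt B + 2 * (Fintype.card ι : ℝ) ^ 2 * cM) ^ (k + α.length) *
        (k + α.length).factorial) * ‖w‖ := by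
  set M := Real.sqrt B + 2 * (Fintype.card ι : ℝ) ^ 2 * cM with hM
  set s := ∑ i, |x i| with hs
  induction k generalizing α with
  | zero =>
    simpa using norm_wordOp_le_of_laplacian_stable A hskew c hbr hcM hc hT hB0 hB α hw
  | succ k ih =>
    have hexp : (∑ i, (x i : ℂ) • A i) ^ (k + 1) * wordOp A α =
        ∑ i, (x i : ℂ) • ((∑ i, (x i : ℂ) • A i) ^ k * wordOp A (i :: α)) := by
      rw [pow_succ, mul_assoc, Finset.sum_mul, Finset.mul_sum]
      refine Finset.sum_congr rfl fun i _ ↦ ?_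
      rw [wordOp_cons, smul_mul_assoc, mul_smul_comm]
    rw [hexp, LinearMap.sum_apply]
    refine (norm_sum_le _ _).trans ?_
    calc ∑ i, ‖((x i : ℂ) • ((∑ i, (x i : ℂ) • A i) ^ k * wordOp A (i :: α))) w‖
        ≤ ∑ i, |x i| * (s ^ k * (M ^ (k + 1 + α.length) * (k + 1 + α.length).factorial) * ‖w‖) := by
          refine Finset.sum_le_sum fun i _ ↦ ?_
          rw [LinearMap.smul_apply, norm_smul, Complex.norm_real, Real.norm_eq_abs]
          refine mul_le_mul_of_nonneg_left ?_ (abs_nonneg _)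
          have := ih (i :: α)
          have e : k + (i :: α).length = k + 1 + α.length := by
            simp only [List.length_cons]; omega
          rwa [e] at this
      _ = s ^ (k + 1) * (M ^ (k + 1 + α.length) * (k + 1 + α.length).factorial) * ‖w‖ := by
          rw [← Finset.sum_mul, ← hs, pow_succ]
          ring

end Literature.Analysis.OperatorTheory

namespace Literature.NumberTheory.Automorphic

/-- `(m + n)! ≤ 2^(m+n) · m! · n!` (from `(m+n)! = C(m+n, n) m! n!` and `C(m+n, n) ≤ 2^(m+n)`).
[folklore] -/
private theorem factorial_add_le_two_pow_mul_factorial_mul (m n : ℕ) :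
    (m + n).factorial ≤ 2 ^ (m + n) * m.factorial * n.factorial := by
  rw [← Nat.add_choose_mul_factorial_mul_factorial m n]
  exact Nat.mul_le_mul_right _ (Nat.mul_le_mul_right _ (Nat.choose_le_two_pow _ _))

variable {K : Type} [Field K] [NumberField K] {𝒢 : AdelicGroupData K}
  {μ : Measure 𝒢.automorphicQuotient}
  {A : Type*} [NormedCommRing A] [NormedAlgebra ℝ A] [NormedAlgebra ℚ A] [CompleteSpace A]
  [StarRing A] {N : Type*} [Fintype N] [DecidableEq N]
  {𝒟 : AutomorphyDatum 𝒢 A N} {W : Submodule ℂ (𝒢.Adelic → ℂ)}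

/-! ### 1. Words in the generators applied to a `Δ`-stable `T` (with `ρ`) -/

namespace IsL2LieStable

variable (h : IsL2LieStable 𝒟 μ W) (ρ : 𝒟.arch.lie →ₗ⁅ℝ⁆ Module.End ℂ W)
  (hρ : ∀ (X : 𝒟.arch.lie) (φ : W), ((ρ X φ : W) : 𝒢.Adelic → ℂ) = lieDeriv 𝒟.ofArch X φ)
include h hρ

variable [𝒢.IsAutomorphicMeasure μ]

/-- **Nelson's estimate for words** (any datum). With `X₁, …, X_d ∈ 𝔤` having brackets in their
real span and `T ≤ W` finite-dimensional `∑ᵢ Xᵢ²`-stable, there is `M ≥ 0` with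
`‖[X^m (X_{α₁} ⋯ X_{αₙ} φ)]‖ ≤ (∑|xᵢ|)^m M^(m+n) (m+n)! ‖[φ]‖` for `X = ∑ xᵢ Xᵢ`, every word
`α`, every `φ ∈ T`, every `m`. Nelson 1959, §8; Harish-Chandra 1953, Lemma 34.
[cite: Nelson1959, §8] -/
theorem exists_norm_cl_lieHom_pow_prod_le {I : Type*} [Fintype I] (Xf : I → 𝒟.arch.lie)
    (hbr : ∀ i j, ⁅Xf i, Xf j⁆ ∈ Submodule.span ℝ (Set.range Xf)) (T : Submodule ℂ W)
    [FiniteDimensional ℂ T] (hT : ∀ u ∈ T, (∑ i, ρ (Xf i) * ρ (Xf i)) u ∈ T) :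
    ∃ M : ℝ, 0 ≤ M ∧ ∀ (x : I → ℝ) (l : List I) (φ : W), φ ∈ T → ∀ m : ℕ,
      ‖h.cl ((ρ (∑ i, x i • Xf i) ^ m) ((l.map fun i ↦ ρ (Xf i)).prod φ))‖ ≤
        (∑ i, |x i|) ^ m * (M ^ (m + l.length) * (m + l.length).factorial) * ‖h.cl φ‖ := by
  classical
  choose c hc' using fun i j ↦ (Submodule.mem_span_range_iff_exists_fun ℝ).mp (hbr i j)
  have hbr : ∀ i j, ⁅Xf i, Xf j⁆ = ∑ l, c i j l • Xf l := fun i j ↦ (hc' i j).symm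
  letI : NormedAddCommGroup W := @InnerProductSpace.Core.toNormedAddCommGroup ℂ W _ _ _ h.innerCore
  letI : InnerProductSpace ℂ W := InnerProductSpace.ofCore _
  have hnorm : ∀ φ : W, ‖φ‖ = ‖h.cl φ‖ := fun φ ↦ by
    rw [@norm_eq_sqrt_re_inner ℂ, @norm_eq_sqrt_re_inner ℂ]
    rfl
  set Af : I → Module.End ℂ W := fun i ↦ ρ (Xf i) with hAf
  have hskew : ∀ i (u w : W), ⟪Af i u, w⟫_ℂ = -⟪u, Af i w⟫_ℂ := fun i u w ↦ by
    rw [eq_neg_iff_add_eq_zero]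
    exact h.inner_cl_lieHom_add_inner_cl_lieHom ρ hρ (Xf i) u w
  have hbr' : ∀ i j, Af i * Af j - Af j * Af i = ∑ l, (c i j l : ℂ) • Af l := fun i j ↦
    h.isLieStableSmooth.lieHom_mul_sub_mul_eq_sum ρ hρ Xf c hbr i j
  set cM : ℝ := ∑ i, ∑ j, ∑ l, |c i j l| with hcM
  have hcM0 : 0 ≤ cM := by positivity
  have hcle : ∀ i j l, |c i j l| ≤ cM := fun i j l ↦ by
    rw [hcM]
    refine le_trans ?_ (Finset.single_le_sum (f := fun i ↦ ∑ j, ∑ l, |c i j l|)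
      (fun _ _ ↦ by positivity) (Finset.mem_univ i))
    refine le_trans ?_ (Finset.single_le_sum (f := fun j ↦ ∑ l, |c i j l|)
      (fun _ _ ↦ by positivity) (Finset.mem_univ j))
    exact Finset.single_le_sum (f := fun l ↦ |c i j l|) (fun _ _ ↦ abs_nonneg _) (Finset.mem_univ l)
  have hlap : ∀ u ∈ T, Literature.Analysis.OperatorTheory.laplacian Af u ∈ T := fun u hu ↦ by
    rw [Literature.Analysis.OperatorTheory.laplacian]
    exact hT u hu
  obtain ⟨B, hB0, hB⟩ := Literature.Analysis.OperatorTheory.exists_norm_laplacian_le Af T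
  refine ⟨Real.sqrt B + 2 * (Fintype.card I : ℝ) ^ 2 * cM, by positivity, fun x l φ hφ m ↦ ?_⟩
  have key := Literature.Analysis.OperatorTheory.norm_pow_sum_smul_mul_wordOp_le_of_laplacian_stable
    Af hskew c hbr' hcM0 hcle hlap hB0 hB x m l hφ
  rw [hnorm, hnorm] at key
  have hsum : (∑ i, (x i : ℂ) • Af i) = ρ (∑ i, x i • Xf i) := by
    rw [h.isLieStableSmooth.lieHom_sum_smul_eq ρ hρ]
  rw [hsum, Module.End.mul_apply] at key
  exact key

/-- **Words applied to a `Δ`-stable `T` have analytic orbits** (any datum). If `X₁, …, X_d` span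
`𝔤`, `T ≤ W` is finite-dimensional and `∑ᵢ Xᵢ²`-stable, `φ ∈ T` and `l` is a word in the
generators, then `t ↦ R(exp tX) [X_{l₁} ⋯ X_{lₙ} φ]` is real analytic at every `t₀`, for every
`X ∈ 𝔤` (`(m+n)! ≤ 2^{m+n} m! n!` turns the word estimate into `C (2Ms)^m m!`).
Harish-Chandra 1953, §7 Thm. 2 and Lemma 34; Nelson 1959, §8. [cite: HarishChandraTAMS1953, Lemma 34 (p. 228)] -/
theorem analyticAt_rightRegular_cl_prod_of_laplacian_stable {I : Type*} [Fintype I]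
    (Xf : I → 𝒟.arch.lie) (hXf : Submodule.span ℝ (Set.range Xf) = ⊤) (T : Submodule ℂ W)
    [FiniteDimensional ℂ T] (hT : ∀ u ∈ T, (∑ i, ρ (Xf i) * ρ (Xf i)) u ∈ T) {φ : W} (hφ : φ ∈ T)
    (l : List I) (X : 𝒟.arch.lie) (t₀ : ℝ) :
    AnalyticAt ℝ (fun t : ℝ ↦ 𝒢.rightRegular μ (𝒟.ofArch (𝒟.arch.expMem (t • X)))
      (h.cl ((l.map fun i ↦ ρ (Xf i)).prod φ))) t₀ := by
  have hbr : ∀ i j, ⁅Xf i, Xf j⁆ ∈ Submodule.span ℝ (Set.range Xf) := fun i j ↦ by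
    rw [hXf]; trivial
  obtain ⟨M, hM0, hM⟩ := h.exists_norm_cl_lieHom_pow_prod_le ρ hρ Xf hbr T hT
  have hX : X ∈ Submodule.span ℝ (Set.range Xf) := by rw [hXf]; trivial
  obtain ⟨x, hx⟩ := (Submodule.mem_span_range_iff_exists_fun ℝ).mp hX
  rw [← hx]
  set s : ℝ := ∑ i, |x i| with hs
  set n : ℕ := l.length with hn
  have hs0 : 0 ≤ s := Finset.sum_nonneg fun i _ ↦ abs_nonneg _
  refine h.analyticAt_rightRegular_cl_of_norm_lieHom_pow_le ρ hρ _ _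
    (C := (2 : ℝ) ^ n * n.factorial * M ^ n * ‖h.cl φ‖) (M := 2 * M * s) (fun m ↦ ?_) t₀
  have hfact : ((m + n).factorial : ℝ) ≤ (2 : ℝ) ^ (m + n) * m.factorial * n.factorial := by
    exact_mod_cast factorial_add_le_two_pow_mul_factorial_mul m n
  calc ‖h.cl ((ρ (∑ i, x i • Xf i) ^ m) ((l.map fun i ↦ ρ (Xf i)).prod φ))‖
      ≤ s ^ m * (M ^ (m + n) * (m + n).factorial) * ‖h.cl φ‖ := hM x l φ hφ m
    _ ≤ s ^ m * (M ^ (m + n) * ((2 : ℝ) ^ (m + n) * m.factorial * n.factorial)) * ‖h.cl φ‖ := by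
      gcongr
    _ = (2 : ℝ) ^ n * n.factorial * M ^ n * ‖h.cl φ‖ * (2 * M * s) ^ m * m.factorial := by
      rw [pow_add, pow_add, mul_pow, mul_pow]
      ring

/-- The analytic vectors form a subspace: every element of the complex span `G` of the words
`X_{l₁} ⋯ X_{lₙ} φ` (`φ ∈ T`, `lᵢ` generators) has analytic orbits `t ↦ R(exp tX) [ψ]`.
Harish-Chandra 1953, §7 (the well-behaved vectors form a `π(𝔅)`-stable linear space).
[cite: HarishChandraTAMS1953, §7, Thm. 2 (pp. 209–210)] -/
theorem analyticAt_rightRegular_cl_of_mem_span_prod {I : Type*} [Fintype I]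
    (Xf : I → 𝒟.arch.lie) (hXf : Submodule.span ℝ (Set.range Xf) = ⊤) (T : Submodule ℂ W)
    [FiniteDimensional ℂ T] (hT : ∀ u ∈ T, (∑ i, ρ (Xf i) * ρ (Xf i)) u ∈ T) {ψ : W}
    (hψ : ψ ∈ Submodule.span ℂ {χ : W | ∃ (l : List I) (φ : W), φ ∈ T ∧
      χ = (l.map fun i ↦ ρ (Xf i)).prod φ})
    (X : 𝒟.arch.lie) (t₀ : ℝ) :
    AnalyticAt ℝ (fun t : ℝ ↦ 𝒢.rightRegular μ (𝒟.ofArch (𝒟.arch.expMem (t • X))) (h.cl ψ)) t₀ := by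
  induction hψ using Submodule.span_induction generalizing t₀ with
  | mem χ hχ =>
    obtain ⟨l, φ, hφ, rfl⟩ := hχ
    exact h.analyticAt_rightRegular_cl_prod_of_laplacian_stable ρ hρ Xf hXf T hT hφ l X t₀
  | zero =>
    simp only [map_zero]
    exact analyticAt_const
  | add χ₁ χ₂ _ _ ih₁ ih₂ =>
    simp only [map_add]
    exact (ih₁ t₀).add (ih₂ t₀)
  | smul a χ _ ih =>
    simp only [map_smul]
    exact (analyticAt_const (v := a)).smul (ih t₀)

omit h in
/-- The span `G` of the words applied to `T` is `𝔤`-stable: `ρ X` maps `G` into `G` for every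
`X ∈ 𝔤` (a generator lengthens each word; a general `X` is a real combination of generators).
Harish-Chandra 1953, §7. [cite: HarishChandraTAMS1953, §7 (p. 209)] -/
theorem lieHom_apply_mem_span_prod (h : IsLieStableSmooth 𝒟 W) {I : Type*} [Fintype I]
    (Xf : I → 𝒟.arch.lie) (hXf : Submodule.span ℝ (Set.range Xf) = ⊤) (T : Submodule ℂ W)
    (X : 𝒟.arch.lie) {ψ : W}
    (hψ : ψ ∈ Submodule.span ℂ {χ : W | ∃ (l : List I) (φ : W), φ ∈ T ∧
      χ = (l.map fun i ↦ ρ (Xf i)).prod φ}) :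
    ρ X ψ ∈ Submodule.span ℂ {χ : W | ∃ (l : List I) (φ : W), φ ∈ T ∧
      χ = (l.map fun i ↦ ρ (Xf i)).prod φ} := by
  set G := Submodule.span ℂ {χ : W | ∃ (l : List I) (φ : W), φ ∈ T ∧
      χ = (l.map fun i ↦ ρ (Xf i)).prod φ} with hG
  -- generators first
  have hgen : ∀ i, ∀ χ ∈ G, ρ (Xf i) χ ∈ G := by
    intro i χ hχ
    have hle : G.map (ρ (Xf i)) ≤ G := by
      rw [hG, Submodule.map_span_le]
      rintro _ ⟨l, φ, hφ, rfl⟩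
      refine Submodule.subset_span ⟨i :: l, φ, hφ, ?_⟩
      rw [List.map_cons, List.prod_cons, Module.End.mul_apply]
    exact hle (Submodule.mem_map_of_mem hχ)
  have hX : X ∈ Submodule.span ℝ (Set.range Xf) := by rw [hXf]; trivial
  obtain ⟨x, hx⟩ := (Submodule.mem_span_range_iff_exists_fun ℝ).mp hX
  rw [← hx, h.lieHom_sum_smul_eq ρ hρ, LinearMap.sum_apply]
  exact G.sum_mem fun i _ ↦ by
    rw [LinearMap.smul_apply]
    exact G.smul_mem _ (hgen i ψ hψ)

omit h in
/-- The span `G` of the words applied to `T` contains every iterated Lie derivative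
`X₁ (X₂ (⋯ (Xₙ φ)))` of an element of `T` along ARBITRARY `Xᵢ ∈ 𝔤`. [cite: HarishChandraTAMS1953, §7 (p. 209)] -/
theorem mk_iterLieDeriv_mem_span_prod (h : IsLieStableSmooth 𝒟 W) {I : Type*} [Fintype I]
    (Xf : I → 𝒟.arch.lie) (hXf : Submodule.span ℝ (Set.range Xf) = ⊤) (T : Submodule ℂ W)
    {φ : W} (hφ : φ ∈ T) (l : List 𝒟.arch.lie) :
    (⟨iterLieDeriv 𝒟.ofArch l φ, h.iterLieDeriv_mem l φ.2⟩ : W) ∈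
      Submodule.span ℂ {χ : W | ∃ (l : List I) (φ : W), φ ∈ T ∧
        χ = (l.map fun i ↦ ρ (Xf i)).prod φ} := by
  induction l with
  | nil =>
    refine Submodule.subset_span ⟨[], φ, hφ, ?_⟩
    simp
  | cons X l ih =>
    have e : (⟨iterLieDeriv 𝒟.ofArch (X :: l) φ, h.iterLieDeriv_mem (X :: l) φ.2⟩ : W) =
        ρ X ⟨iterLieDeriv 𝒟.ofArch l φ, h.iterLieDeriv_mem l φ.2⟩ :=
      Subtype.ext (by
        change iterLieDeriv 𝒟.ofArch (X :: l) (φ : 𝒢.Adelic → ℂ) =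
          ((ρ X ⟨iterLieDeriv 𝒟.ofArch l φ, h.iterLieDeriv_mem l φ.2⟩ : W) : 𝒢.Adelic → ℂ)
        rw [hρ, iterLieDeriv_cons])
    rw [e]
    exact lieHom_apply_mem_span_prod ρ hρ h Xf hXf T X ih

end IsL2LieStable

/-! ### 2. The `ρ`-free statements: the Lie span of `V` -/

section RhoFree

variable [FiniteDimensional ℝ A] [𝒢.IsAutomorphicMeasure μ]

namespace IsL2LieStable

variable (h : IsL2LieStable 𝒟 μ W)
include h

/-- **The `U(𝔤)`-span of a `Δ`-finite subspace consists of analytic vectors** (any automorphy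
datum). Let `X₁, …, X_d` span `𝔤`, `V ≤ W` finite-dimensional with `∑ᵢ Xᵢ (Xᵢ ψ) ∈ V` for
`ψ ∈ V`, and let `φ` lie in the complex span of the iterated Lie derivatives `Y₁ (⋯ (Yₙ ψ))`
(`Yᵢ ∈ 𝔤` arbitrary, `ψ ∈ V`; this span is the `𝔤`-stable space generated by `V`). Then for
`f ∈ ℒ²(μ)` with `invQuot f = φ`, the orbit `t ↦ R(exp tX) [f]` is real analytic at every `t₀`, for
every `X ∈ 𝔤`. Harish-Chandra 1953, Lemma 34 and §7; Nelson 1959, §8. [cite: HarishChandraTAMS1953, Lemma 34 (p. 228)] -/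
theorem analyticAt_rightRegular_toLp_of_mem_lieSpan_of_laplacian_stable {I : Type*} [Fintype I]
    (Xf : I → 𝒟.arch.lie) (hXf : Submodule.span ℝ (Set.range Xf) = ⊤)
    (V : Submodule ℂ (𝒢.Adelic → ℂ)) [FiniteDimensional ℂ V] (hVW : V ≤ W)
    (hΔ : ∀ ψ ∈ V, ∑ i, lieDeriv 𝒟.ofArch (Xf i) (lieDeriv 𝒟.ofArch (Xf i) ψ) ∈ V)
    {φ : 𝒢.Adelic → ℂ}
    (hφ : φ ∈ Submodule.span ℂ {χ | ∃ (l : List 𝒟.arch.lie) (ψ : 𝒢.Adelic → ℂ), ψ ∈ V ∧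
      χ = iterLieDeriv 𝒟.ofArch l ψ})
    {f : 𝒢.automorphicQuotient → ℂ} (hf : MemLp f 2 μ) (hfφ : invQuot 𝒢 f = φ)
    (X : 𝒟.arch.lie) (t₀ : ℝ) :
    AnalyticAt ℝ (fun t : ℝ ↦ 𝒢.rightRegular μ (𝒟.ofArch (𝒟.arch.expMem (t • X))) (hf.toLp f)) t₀ := by
  obtain ⟨ρ, hρ⟩ := h.isLieStableSmooth.exists_lieHom
  let T : Submodule ℂ W := V.comap W.subtype
  haveI : FiniteDimensional ℂ T :=
    LinearEquiv.finiteDimensional (Submodule.comapSubtypeEquivOfLe hVW).symm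
  have hT : ∀ u ∈ T, (∑ i, ρ (Xf i) * ρ (Xf i)) u ∈ T := fun u hu ↦ by
    change (((∑ i, ρ (Xf i) * ρ (Xf i)) u : W) : 𝒢.Adelic → ℂ) ∈ V
    rw [IsLieStableSmooth.coe_sum_lieHom_mul_lieHom_apply ρ hρ]
    exact hΔ _ hu
  -- the function-level Lie span is the image of the span `G` of words inside `W`
  set G : Submodule ℂ W := Submodule.span ℂ {χ : W | ∃ (l : List I) (φ₀ : W), φ₀ ∈ T ∧
      χ = (l.map fun i ↦ ρ (Xf i)).prod φ₀} with hG
  have hle : Submodule.span ℂ {χ | ∃ (l : List 𝒟.arch.lie) (ψ : 𝒢.Adelic → ℂ), ψ ∈ V ∧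
      χ = iterLieDeriv 𝒟.ofArch l ψ} ≤ G.map W.subtype := by
    rw [Submodule.span_le]
    rintro _ ⟨l, ψ, hψ, rfl⟩
    refine ⟨⟨iterLieDeriv 𝒟.ofArch l ψ, h.isLieStableSmooth.iterLieDeriv_mem l (hVW hψ)⟩, ?_, rfl⟩
    exact mk_iterLieDeriv_mem_span_prod ρ hρ h.isLieStableSmooth Xf hXf T (φ := ⟨ψ, hVW hψ⟩) hψ l
  obtain ⟨φ', hφ'G, hφ'⟩ := hle hφ
  have hcl : h.cl φ' = hf.toLp f := h.cl_eq_toLp hf (hfφ.trans hφ'.symm)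
  rw [← hcl]
  exact h.analyticAt_rightRegular_cl_of_mem_span_prod ρ hρ Xf hXf T hT hφ'G X t₀

/-- Matrix-coefficient form of
`analyticAt_rightRegular_toLp_of_mem_lieSpan_of_laplacian_stable`: `t ↦ ⟪u, R(exp tX) [f]⟫` is
real analytic at every `t₀` for every `u ∈ L²(μ)` — the hypothesis `hana` of
`closure_l2OfForms_exp_invariant_of_analytic(_of_memLp)` for the Lie span of `V`.
[cite: HarishChandraTAMS1953, Lemma 34 (p. 228)] -/
theorem analyticAt_inner_rightRegular_toLp_of_mem_lieSpan_of_laplacian_stable {I : Type*}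
    [Fintype I] (Xf : I → 𝒟.arch.lie) (hXf : Submodule.span ℝ (Set.range Xf) = ⊤)
    (V : Submodule ℂ (𝒢.Adelic → ℂ)) [FiniteDimensional ℂ V] (hVW : V ≤ W)
    (hΔ : ∀ ψ ∈ V, ∑ i, lieDeriv 𝒟.ofArch (Xf i) (lieDeriv 𝒟.ofArch (Xf i) ψ) ∈ V)
    {φ : 𝒢.Adelic → ℂ}
    (hφ : φ ∈ Submodule.span ℂ {χ | ∃ (l : List 𝒟.arch.lie) (ψ : 𝒢.Adelic → ℂ), ψ ∈ V ∧
      χ = iterLieDeriv 𝒟.ofArch l ψ})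
    {f : 𝒢.automorphicQuotient → ℂ} (hf : MemLp f 2 μ) (hfφ : invQuot 𝒢 f = φ)
    (X : 𝒟.arch.lie) (u : 𝒢.L2 μ) (t₀ : ℝ) :
    AnalyticAt ℝ (fun t : ℝ ↦
      ⟪u, 𝒢.rightRegular μ (𝒟.ofArch (𝒟.arch.expMem (t • X))) (hf.toLp f)⟫_ℂ) t₀ := by
  have han := h.analyticAt_rightRegular_toLp_of_mem_lieSpan_of_laplacian_stable Xf hXf V hVW hΔ hφ
    hf hfφ X t₀
  have h2 := (((innerSL ℂ u).restrictScalars ℝ).analyticAt _).comp han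
  simpa only [Function.comp_def, ContinuousLinearMap.coe_restrictScalars', innerSL_apply_apply] using h2

/-- **The `U(𝔤)`-span of a `𝔨`-finite `𝔭^∓`-null subspace consists of analytic vectors** (any
automorphy datum; Cauchy–Riemann route). Hypotheses on `(Y, P, Q)`, `V`, `c` as in
`analyticAt_rightRegular_toLp_of_null`; conclusion for every `φ` in the complex span of the
iterated Lie derivatives of elements of `V` and `f ∈ ℒ²(μ)` with `invQuot f = φ`: the orbit
`t ↦ R(exp tX) [f]` is real analytic at every `t₀`, for every `X ∈ 𝔤`. Harish-Chandra 1953,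
Lemma 34; Nelson 1959, §8; Knapp 1986, Ch. VIII. [cite: HarishChandraTAMS1953, Lemma 34 (p. 228)] -/
theorem analyticAt_rightRegular_toLp_of_mem_lieSpan_of_null {ιK ιP : Type*} [Fintype ιK]
    [Fintype ιP] (Y : ιK → 𝒟.arch.lie) (P Q : ιP → 𝒟.arch.lie)
    (hspan : Submodule.span ℝ (Set.range (Sum.elim Y (Sum.elim P Q))) = ⊤)
    (hPQ : ∀ b, ⁅P b, Q b⁆ ∈ Submodule.span ℝ (Set.range Y))
    (V : Submodule ℂ (𝒢.Adelic → ℂ)) [FiniteDimensional ℂ V] (hVW : V ≤ W)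
    (hVY : ∀ a, ∀ ψ ∈ V, lieDeriv 𝒟.ofArch (Y a) ψ ∈ V) (c : ℂ) (hc : c * c = -1)
    (hnull : ∀ b, ∀ ψ ∈ V, lieDeriv 𝒟.ofArch (Q b) ψ = c • lieDeriv 𝒟.ofArch (P b) ψ)
    {φ : 𝒢.Adelic → ℂ}
    (hφ : φ ∈ Submodule.span ℂ {χ | ∃ (l : List 𝒟.arch.lie) (ψ : 𝒢.Adelic → ℂ), ψ ∈ V ∧
      χ = iterLieDeriv 𝒟.ofArch l ψ})
    {f : 𝒢.automorphicQuotient → ℂ} (hf : MemLp f 2 μ) (hfφ : invQuot 𝒢 f = φ)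
    (X : 𝒟.arch.lie) (t₀ : ℝ) :
    AnalyticAt ℝ (fun t : ℝ ↦ 𝒢.rightRegular μ (𝒟.ofArch (𝒟.arch.expMem (t • X))) (hf.toLp f)) t₀ := by
  refine h.analyticAt_rightRegular_toLp_of_mem_lieSpan_of_laplacian_stable (Sum.elim Y (Sum.elim P Q))
    hspan V hVW (fun ψ hψ ↦ ?_) hφ hf hfφ X t₀
  have hsm : IsArchSmooth 𝒟.ofArch ψ := h.smooth ψ (hVW hψ)
  rw [Fintype.sum_sum_type, Fintype.sum_sum_type]
  simp only [Sum.elim_inl, Sum.elim_inr]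
  refine V.add_mem (V.sum_mem fun a _ ↦ hVY a _ (hVY a _ hψ)) ?_
  rw [← Finset.sum_add_distrib]
  refine V.sum_mem fun b _ ↦ ?_
  rw [lieDeriv_lieDeriv_add_of_null (P b) (Q b) c hc hsm (hnull b ψ hψ)]
  refine V.smul_mem _ ?_
  obtain ⟨r, hr⟩ := (Submodule.mem_span_range_iff_exists_fun ℝ).mp (hPQ b)
  rw [← hr, hsm.lieDeriv_sum_smul_left 𝒟.ofArch]
  exact V.sum_mem fun a _ ↦ V.smul_of_tower_mem _ (hVY a _ hψ)

/-- Matrix-coefficient form of `analyticAt_rightRegular_toLp_of_mem_lieSpan_of_null`.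
[cite: HarishChandraTAMS1953, Lemma 34 (p. 228)] -/
theorem analyticAt_inner_rightRegular_toLp_of_mem_lieSpan_of_null {ιK ιP : Type*} [Fintype ιK]
    [Fintype ιP] (Y : ιK → 𝒟.arch.lie) (P Q : ιP → 𝒟.arch.lie)
    (hspan : Submodule.span ℝ (Set.range (Sum.elim Y (Sum.elim P Q))) = ⊤)
    (hPQ : ∀ b, ⁅P b, Q b⁆ ∈ Submodule.span ℝ (Set.range Y))
    (V : Submodule ℂ (𝒢.Adelic → ℂ)) [FiniteDimensional ℂ V] (hVW : V ≤ W)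
    (hVY : ∀ a, ∀ ψ ∈ V, lieDeriv 𝒟.ofArch (Y a) ψ ∈ V) (c : ℂ) (hc : c * c = -1)
    (hnull : ∀ b, ∀ ψ ∈ V, lieDeriv 𝒟.ofArch (Q b) ψ = c • lieDeriv 𝒟.ofArch (P b) ψ)
    {φ : 𝒢.Adelic → ℂ}
    (hφ : φ ∈ Submodule.span ℂ {χ | ∃ (l : List 𝒟.arch.lie) (ψ : 𝒢.Adelic → ℂ), ψ ∈ V ∧
      χ = iterLieDeriv 𝒟.ofArch l ψ})
    {f : 𝒢.automorphicQuotient → ℂ} (hf : MemLp f 2 μ) (hfφ : invQuot 𝒢 f = φ)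
    (X : 𝒟.arch.lie) (u : 𝒢.L2 μ) (t₀ : ℝ) :
    AnalyticAt ℝ (fun t : ℝ ↦
      ⟪u, 𝒢.rightRegular μ (𝒟.ofArch (𝒟.arch.expMem (t • X))) (hf.toLp f)⟫_ℂ) t₀ := by
  have han := h.analyticAt_rightRegular_toLp_of_mem_lieSpan_of_null Y P Q hspan hPQ V hVW hVY c hc
    hnull hφ hf hfφ X t₀
  have h2 := (((innerSL ℂ u).restrictScalars ℝ).analyticAt _).comp han
  simpa only [Function.comp_def, ContinuousLinearMap.coe_restrictScalars', innerSL_apply_apply] using h2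

end IsL2LieStable

end RhoFree

end Literature.NumberTheory.Automorphic
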